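import Summits.BirchSwinnertonDyer.BirchSwinnertonDyer.Theorems.SemiOrdinaryEisensteinDescentWildSplitEisensteinValueAtOneVOwnPointDoor
import Literature.NumberTheory.EllipticCurves.CongruenceVisibilityMultiplicative
import Literature.NumberTheory.EllipticCurves.CongruenceVisibilityMultiplicativeTwisted
import Literature.NumberTheory.EllipticCurves.TateCurve.NumberFieldUniformization
import Literature.NumberTheory.EllipticCurves.TateCurve.NumberFieldUniformizationTwisted
import Summits.BirchSwinnertonDyer.Rank1Residual.X11b.SelmerRankOne
import HarnessLib

/-!
# Route `SemiOrdinaryEisensteinDescent`, crux #2″ `WildSplitEisensteinValueAtOneV` (E_𝟙^V, stmt-BirchSwinnertonDyer-26610):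
# the TWO-WITNESS + OWN-POINT visibility door — `(ℤ/p)² ↪ Ш(E)` and `p² ∣ #Ш(E)` WITHOUT the Cassels–Tate pairing
# (cell `pub/bsd-wall`, width seat `bsd-wall-soed-p1-w3` g23; `--supports stmt-BirchSwinnertonDyer-26610`; THEOREMS ONLY;
# Theses-free; cell-free)

WHY. Modulo print and the leaf Z, crux #2″ is «`Typed.MissingLowerBoundAt W 3` for every cell curve `W`» (w3 g14); its nine
in-range content rows (`#Ш(E)_an = 9`) are kernel theorems modulo EXACTLY the named facts Cassels–Tate (`hCT`) and GZK
(`hGZK`) plus Cremona's analytic data (w3 g20–g22). Cassels–Tate enters at ONE point: visibility supplies ONE non-zero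
element of `Ш(E)[3]` and squareness turns `3 ∣ #Ш` into `9 ∣ #Ш`. This door produces TWO independent elements of
`Ш(E)[p]` — `p² ∣ #Ш(E)` by Lagrange alone — so a content row with `ord_p #Ш_an ≤ 2` closes with `hGZK` as ONLY named fact.

THE ARGUMENT (Cremona–Mazur 2000 §3 / Agashe–Stein 2002 Lemma 3.6, the Mordell–Weil term of the TARGET separated by one
local Kummer coordinate): `E(K) = ℤG + pE(K)` (cyclic mod `p`), `T₁, T₂ ∈ E'(K)` INDEPENDENT modulo `pE'(K)` with
`θ_* κ'(T_i)` in the local condition of `E` on `S`, and a finite place `v₀` with BOTH `T_i ∈ p·E'(K_{v₀})` while some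
`G₀ ∈ E(K)` has `G₀ ∉ p·E(K_{v₀})`. If `a f(T₁) + b f(T₂) = 0` in `Ш(E/K)` then `θ_* κ'(aT₁ + bT₂) = κ(Q) = c·κ(G)`;
`res_{v₀}` kills the left side, so `c·res κ(G) = 0`; `p ∤ c` would give `res κ(G₀) = 0`, i.e. `G₀ ∈ pE(K_{v₀})` (w3 g21's
converse of criterion (a)) — excluded; so `p ∣ c`, `aT₁ + bT₂ ∈ pE'(K)`, `p ∣ a, b`: `(a, b) ↦ a f(T₁) + b f(T₂)` is an
INJECTIVE map `(ℤ/p)² → Ш(E/K)` and `p² ∣ #Ш(E/K)` (`pow_dvd_shaOrder_of_injective`). NO Cassels–Tate, no count, no rank of `E'`.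

* §1 algebra: two `p`-torsion elements independent mod `p` give an injective `(Fin 2 → ZMod p) →+ A`.
* §2 `exists_injective_of_congr_of_two_witnesses_of_ownPoint` — the door over any number field `K`, odd `p`.
* §3 over `ℚ`, analytic rank one, `E[p]` irreducible (GZK: `E(ℚ)/pE(ℚ)` cyclic, `Ш(E)` finite):
  `exists_injective_rankOne_irr_…`, **`missingLowerBoundAt_rankOne_irr_of_two_witnesses_of_ownPoint`** (binder `hGZK` ONLY,
  datum `ord_p #Ш_an ≤ 2`) and its PLACES form `…_of_places` (free kinds (i)/(ii)/(iii) on `S ∖ {v₀}`, option (a) at `v₀`).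

The separating place `v₀` may be a place of ADDITIVE reduction of `E` (companion file `…AdditiveOwnPointAtThree.lean`:
`G₀ ∉ 3·E(ℚ₃)` from Tate's algorithm, `c₃ = 1`) — that is how the strict content rows of crux #2″ become Cassels–Tate-free.
HONEST FRAMING: tool theorems; per pair they close nothing by themselves (`θ`, the witnesses, the own point and the local
certificates are INPUTS); the crux stays research-open class-wide; BSD is not proved by any of this.

References: [CremonaMazur2000] §3; [AgasheStein2002] Lemma 3.6; [SilvermanAEC2009] VIII.§2, X.§4; [SilvermanATAEC1994]
V.3.1, V.5.3; [GrossLMS1991] §2; [Miller2011LMS] Def. 1.1.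
-/

set_option autoImplicit false
set_option linter.dupNamespace false -- the Theorems namespace repeats the summit name by design (D-0017 nested layout)

noncomputable section

open scoped Classical

open WeierstrassCurve Literature.NumberTheory.EllipticCurves
  Literature.NumberTheory.EllipticCurves.Rank1Residual
  Literature.NumberTheory.EllipticCurves.Rank1Residual.Typed
  Literature.NumberTheory.GaloisRepresentations
  Summit.BirchSwinnertonDyer.Rank1Residual.GaloisImage
open NumberField IsDedekindDomain Rat.HeightOneSpectrum Field

namespace Summit.BirchSwinnertonDyer.BirchSwinnertonDyer.Theorems.VisibleTwoWitnessOwnPoint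

/-! ## §1 Algebra: two independent `p`-torsion elements give `(ℤ/p)² ↪ A` -/

section Algebra

universe u

variable {A : Type u} [AddCommGroup A] {p : ℕ} [hp : Fact p.Prime]

/-- **Two elements killed by `p` and independent modulo `p` span a copy of `(ℤ/p)²`**: if `p • c₁ = p • c₂ = 0` and
`a • c₁ + b • c₂ = 0 ⟹ p ∣ a ∧ p ∣ b`, then `g ↦ g₀ • c₁ + g₁ • c₂` is an injective additive map `(Fin 2 → ZMod p) → A`
(`ZMod.lift` on each coordinate). [folklore] -/
theorem exists_injective_of_two_independent (c₁ c₂ : A) (h₁ : p • c₁ = 0) (h₂ : p • c₂ = 0)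
    (hind : ∀ a b : ℤ, a • c₁ + b • c₂ = 0 → (p : ℤ) ∣ a ∧ (p : ℤ) ∣ b) :
    ∃ f : (Fin 2 → ZMod p) →+ A, Function.Injective f := by
  have h₁' : (zmultiplesHom A c₁) (p : ℤ) = 0 := by simp [h₁]
  have h₂' : (zmultiplesHom A c₂) (p : ℤ) = 0 := by simp [h₂]
  let f₁ : ZMod p →+ A := ZMod.lift p ⟨zmultiplesHom A c₁, h₁'⟩
  let f₂ : ZMod p →+ A := ZMod.lift p ⟨zmultiplesHom A c₂, h₂'⟩
  refine ⟨f₁.comp (Pi.evalAddMonoidHom (fun _ : Fin 2 ↦ ZMod p) 0) +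
    f₂.comp (Pi.evalAddMonoidHom (fun _ : Fin 2 ↦ ZMod p) 1), ?_⟩
  rw [injective_iff_map_eq_zero]
  intro g hg
  obtain ⟨a, ha⟩ := ZMod.intCast_surjective (g 0)
  obtain ⟨b, hb⟩ := ZMod.intCast_surjective (g 1)
  have hf₁ : f₁ (g 0) = a • c₁ := by
    rw [← ha]; exact (ZMod.lift_coe p _ a).trans (by simp)
  have hf₂ : f₂ (g 1) = b • c₂ := by
    rw [← hb]; exact (ZMod.lift_coe p _ b).trans (by simp)
  have hsum : a • c₁ + b • c₂ = 0 := by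
    rw [← hf₁, ← hf₂]
    simpa using hg
  obtain ⟨hpa, hpb⟩ := hind a b hsum
  funext i
  fin_cases i
  · change g 0 = 0
    rw [← ha]
    exact (ZMod.intCast_zmod_eq_zero_iff_dvd a p).mpr hpa
  · change g 1 = 0
    rw [← hb]
    exact (ZMod.intCast_zmod_eq_zero_iff_dvd b p).mpr hpb

end Algebra

/-! ## §2 The TWO-WITNESS + OWN-POINT visibility theorem (any number field `K`, odd `p`) -/

section Door

variable {K : Type} [Field K] [NumberField K] (W W' : WeierstrassCurve K) [W.IsElliptic]
  [W'.IsElliptic] {p : ℕ} [hp : Fact p.Prime]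

/-- **Visibility with TWO witnesses and ONE own point: `(ℤ/p)² ↪ Ш(E/K)`.** `E = W`, `E' = W'` elliptic over a number
field `K`, `p` odd, `θ : E'[p] ⥲ E[p]` a `Γ_K`-isomorphism, `S` ⊇ bad places and places above `p`, `E(K)/pE(K)` CYCLIC;
`T₁, T₂ ∈ E'(K)` independent mod `pE'(K)` with `θ_* κ'(T_i)` in the local condition of `E` on `S`; `v₀` ANY finite place
with `T₁, T₂ ∈ p·E'(K_{v₀})` and `G₀ ∉ p·E(K_{v₀})` for some `G₀ ∈ E(K)`. Then there is an INJECTIVE additive map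
`(ℤ/p)² → Ш(E/K)` onto the span of the visible classes `f(T₁), f(T₂)` (module docstring; ingredients
`mem_range_kummerMapTorsion_of_torsionH1ToH1_eq_zero`, criterion (a) `res_kummerMapTorsion_eq_zero_of_exists_smul_eq`,
`res_h1Equiv_eq_zero_of_res_eq_zero`, the converse `VisibleOwnPoint.exists_smul_eq_baseChange_of_res_kummerMapTorsion_eq_zero`,
`kummerMapTorsion_ker`). NO Cassels–Tate, no index, no rank of `E'`. [cite: CremonaMazur2000, §3] [cite: AgasheStein2002, Lemma 3.6] -/
theorem exists_injective_of_congr_of_two_witnesses_of_ownPoint (hp2 : p ≠ 2)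
    (θ : geomTorsion W' (p : ℤ) ≃+ geomTorsion W (p : ℤ))
    (hθ : ∀ (σ : absoluteGaloisGroup K) (P : geomTorsion W' (p : ℤ)), θ (σ • P) = σ • θ P)
    (S : Finset (HeightOneSpectrum (𝓞 K)))
    (hS : ∀ v : HeightOneSpectrum (𝓞 K), v ∉ S →
      W.HasGoodReductionAt v ∧ W'.HasGoodReductionAt v ∧ (p : 𝓞 K) ∉ v.asIdeal)
    (hdiv' : ∀ P : geomPoints W', ∃ Q : geomPoints W', (p : ℤ) • Q = P)
    (hE : ∃ G : W.toAffine.Point, ∀ Q : W.toAffine.Point,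
      ∃ (a : ℤ) (R : W.toAffine.Point), Q = a • G + (p : ℤ) • R)
    (T₁ T₂ : W'.toAffine.Point)
    (hind : ∀ a b : ℤ, a • T₁ + b • T₂ ∈
      (zsmulAddGroupHom (p : ℤ) : W'.toAffine.Point →+ W'.toAffine.Point).range →
      (p : ℤ) ∣ a ∧ (p : ℤ) ∣ b)
    (hloc₁ : ∀ v ∈ S, h1Equiv θ hθ (kummerMapTorsion W' (p : ℤ) hdiv' T₁) ∈
      selmerLocalKer W (v.adicCompletion K) (p : ℤ))
    (hloc₂ : ∀ v ∈ S, h1Equiv θ hθ (kummerMapTorsion W' (p : ℤ) hdiv' T₂) ∈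
      selmerLocalKer W (v.adicCompletion K) (p : ℤ))
    (v₀ : HeightOneSpectrum (𝓞 K))
    (hT₁ : ∃ Q : (W'.baseChange (v₀.adicCompletion K)).toAffine.Point,
      p • Q = WeierstrassCurve.Affine.Point.baseChange (W' := W') K (v₀.adicCompletion K) T₁)
    (hT₂ : ∃ Q : (W'.baseChange (v₀.adicCompletion K)).toAffine.Point,
      p • Q = WeierstrassCurve.Affine.Point.baseChange (W' := W') K (v₀.adicCompletion K) T₂)
    (G₀ : W.toAffine.Point)
    (hG₀ : ¬ ∃ Q : (W.baseChange (v₀.adicCompletion K)).toAffine.Point,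
      p • Q = WeierstrassCurve.Affine.Point.baseChange (W' := W) K (v₀.adicCompletion K) G₀) :
    ∃ f : (Fin 2 → ZMod p) →+ W.sha, Function.Injective f := by
  -- the separating completion `L = K_{v₀}` is perfect (characteristic zero)
  haveI : CharZero (v₀.adicCompletion K) :=
    Literature.NumberTheory.GaloisRepresentations.charZero_adicCompletion v₀
  have hpp : p.Prime := Fact.out
  have hn : (p : ℤ) ≠ 0 := by exact_mod_cast hpp.ne_zero
  have hdiv : ∀ P : geomPoints W, ∃ Q : geomPoints W, (p : ℤ) • Q = P :=
    W.zsmul_geomPoints_surjective_holds hn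
  obtain ⟨hsha₁, hpc₁⟩ :=
    VisibleWitness.torsionH1ToH1_h1Equiv_kummerMapTorsion_mem_sha W W' hp2 θ hθ S hS hdiv' T₁ hloc₁
  obtain ⟨hsha₂, hpc₂⟩ :=
    VisibleWitness.torsionH1ToH1_h1Equiv_kummerMapTorsion_mem_sha W W' hp2 θ hθ S hS hdiv' T₂ hloc₂
  set κ := kummerMapTorsion W (p : ℤ) hdiv with hκ
  set κ' := kummerMapTorsion W' (p : ℤ) hdiv' with hκ'
  -- the visibility map `f' : E'(K) → H¹(K, E)` (additive)
  set f' : W'.toAffine.Point →+ W.galH1 :=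
    (torsionH1ToH1 W (p : ℤ)).comp ((h1Equiv θ hθ).toAddMonoidHom.comp κ') with hf'
  have hf'apply : ∀ P : W'.toAffine.Point, f' P = torsionH1ToH1 W (p : ℤ) (h1Equiv θ hθ (κ' P)) :=
    fun _ ↦ rfl
  -- the two visible classes as elements of `Ш(E/K)`
  set c₁ : W.sha := ⟨f' T₁, (hf'apply T₁).symm ▸ hsha₁⟩ with hc₁
  set c₂ : W.sha := ⟨f' T₂, (hf'apply T₂).symm ▸ hsha₂⟩ with hc₂
  have hpc₁' : p • c₁ = 0 := Subtype.ext (by simpa [hc₁, hf'apply] using hpc₁)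
  have hpc₂' : p • c₂ = 0 := Subtype.ext (by simpa [hc₂, hf'apply] using hpc₂)
  refine exists_injective_of_two_independent c₁ c₂ hpc₁' hpc₂' ?_
  -- independence of the two visible classes
  intro a b hab
  -- `f'(aT₁ + bT₂) = 0` in `H¹(K, E)`
  have hab' : f' (a • T₁ + b • T₂) = 0 := by
    have h := congrArg Subtype.val hab
    simpa [hc₁, hc₂, map_add, map_zsmul] using h
  rw [hf'apply] at hab'
  obtain ⟨Q, hQ⟩ := mem_range_kummerMapTorsion_of_torsionH1ToH1_eq_zero W (p : ℤ) hdiv _ hab'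
  obtain ⟨G, hG⟩ := hE
  obtain ⟨c, R, hR⟩ := hG Q
  obtain ⟨d, R', hR'⟩ := hG G₀
  -- `κ` kills `pE(K)`
  have hκp : ∀ R : W.toAffine.Point, κ ((p : ℤ) • R) = 0 := by
    intro R
    have hmem : (p : ℤ) • R ∈ κ.ker := by
      rw [hκ, kummerMapTorsion_ker W (p : ℤ) hdiv]
      exact ⟨R, rfl⟩
    exact hmem
  have hκQ : κ Q = c • κ G := by rw [hR, map_add, map_zsmul, hκp, add_zero]
  have hκG₀ : κ G₀ = d • κ G := by rw [hR', map_add, map_zsmul, hκp, add_zero]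
  -- the combination `aT₁ + bT₂` is locally `p`-divisible at `v₀`, so its class restricts to zero there
  have hTab : ∃ Q' : (W'.baseChange (v₀.adicCompletion K)).toAffine.Point,
      (p : ℤ) • Q' = WeierstrassCurve.Affine.Point.baseChange (W' := W') K (v₀.adicCompletion K) (a • T₁ + b • T₂) := by
    obtain ⟨Q₁, hQ₁⟩ := hT₁
    obtain ⟨Q₂, hQ₂⟩ := hT₂
    -- the base-change map as a bundled hom on `W'(K)` (so that `map_add` / `map_zsmul` fire)
    set ψ : W'.toAffine.Point →+ (W'.baseChange (v₀.adicCompletion K)).toAffine.Point :=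
      WeierstrassCurve.Affine.Point.baseChange (W' := W') K (v₀.adicCompletion K) with hψ
    refine ⟨a • Q₁ + b • Q₂, ?_⟩
    rw [natCast_zsmul, smul_add, smul_comm p a Q₁, smul_comm p b Q₂, hQ₁, hQ₂]
    show a • ψ T₁ + b • ψ T₂ = ψ (a • T₁ + b • T₂)
    rw [map_add, map_zsmul, map_zsmul]
  have hresT : galoisCohomology.res (W'.torsionGaloisModule (p : ℤ)) (v₀.adicCompletion K) 1 (κ' (a • T₁ + b • T₂)) = 0 :=
    VisibleWitness.res_kummerMapTorsion_eq_zero_of_exists_smul_eq W' (v₀.adicCompletion K) hn hdiv' _ hTab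
  -- the restriction `res_L : H¹(K, E[p]) → H¹(L, E[p])`, typed on `galH1Torsion` so that `map_add` / `map_zsmul` fire
  set r : galH1Torsion W (p : ℤ) →+
      galoisCohomology (GaloisRep.restrictField (v₀.adicCompletion K) (W.torsionGaloisModule (p : ℤ))) 1 :=
    galoisCohomology.res (W.torsionGaloisModule (p : ℤ)) (v₀.adicCompletion K) 1 with hr
  have hres : r (c • κ G) = 0 := by
    rw [← hκQ, hQ]
    exact VisibleOwnPoint.res_h1Equiv_eq_zero_of_res_eq_zero W (v₀.adicCompletion K) W' θ hθ _ hresT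
  by_cases hpc : (p : ℤ) ∣ c
  · -- `p ∣ c`: `θ_* κ'(aT₁ + bT₂) = c κ(G) = 0`, so `aT₁ + bT₂ ∈ pE'(K)`, so `p ∣ a, b`
    obtain ⟨m, hm⟩ := hpc
    have hT0 : κ' (a • T₁ + b • T₂) = 0 := by
      apply (map_eq_zero_iff _ (h1Equiv θ hθ).injective).mp
      rw [← hQ, hκQ, hm, mul_comm, ← smul_smul, ← map_zsmul, hκp, zsmul_zero]
    have hmem : a • T₁ + b • T₂ ∈ κ'.ker := hT0
    rw [hκ', kummerMapTorsion_ker W' (p : ℤ) hdiv'] at hmem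
    exact hind a b hmem
  · -- `p ∤ c`: `res_L κ(G) = 0`, so `res_L κ(G₀) = 0`, so `G₀ ∈ pE(L)` — excluded
    exfalso
    have hprime : Prime (p : ℤ) := Nat.prime_iff_prime_int.mp hpp
    obtain ⟨u, w, huw⟩ := (Prime.coprime_iff_not_dvd hprime).mpr hpc
    have hresG : r (κ G) = 0 := by
      have hG1 : κ G = u • κ ((p : ℤ) • G) + w • (c • κ G) := by
        rw [map_zsmul, ← mul_zsmul, ← mul_zsmul, ← add_zsmul, huw, one_zsmul]
      rw [hG1, hκp, zsmul_zero, zero_add, map_zsmul, hres, zsmul_zero]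
    have hresG₀ : r (κ G₀) = 0 := by
      rw [hκG₀, map_zsmul, hresG, zsmul_zero]
    obtain ⟨Q₀, hQ₀⟩ :=
      VisibleOwnPoint.exists_smul_eq_baseChange_of_res_kummerMapTorsion_eq_zero W (v₀.adicCompletion K) hn hdiv
        G₀ hresG₀
    exact hG₀ ⟨Q₀, by rw [← natCast_zsmul]; exact hQ₀⟩

end Door

/-! ## §3 The doors over `ℚ`: analytic rank one, `E[p]` irreducible — binder `hGZK` ONLY (no Cassels–Tate) -/

section RatDoors

open Summit.BirchSwinnertonDyer.BirchSwinnertonDyer.Theorems.AdditiveBranchIMCGordTwoRankOneVisibility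

variable {W : WeierstrassCurve ℚ} [W.IsElliptic] {p : ℕ} [hp : Fact p.Prime]

/-- **`(ℤ/p)² ↪ Ш(E)` by two-witness + own-point visibility, `E/ℚ` of analytic rank one with `E[p]` irreducible, `p` odd**
(GZK + irreducibility give the cyclicity of `E(ℚ)/pE(ℚ)`, `exists_generator_rankOne_of_irr`); per-pair data `W'`, `θ`, `S`,
the two witnesses with their local conditions, the separating place `v` and the own point `G₀` are binders. Per pair.
[cite: CremonaMazur2000, §3] [cite: AgasheStein2002, Lemma 3.6] [cite: GrossLMS1991, §2 (sentence after (2.2))] -/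
theorem exists_injective_rankOne_irr_of_two_witnesses_of_ownPoint
    (hGZK : rank_eq_analyticRank_of_analyticRank_le_one) (hp2 : p ≠ 2)
    (hirr : Irr W p) (hr : W.analyticRank = 1)
    (W' : WeierstrassCurve ℚ) [W'.IsElliptic]
    (θ : geomTorsion W' (p : ℤ) ≃+ geomTorsion W (p : ℤ))
    (hθ : ∀ (σ : absoluteGaloisGroup ℚ) (P : geomTorsion W' (p : ℤ)), θ (σ • P) = σ • θ P)
    (S : Finset (HeightOneSpectrum (𝓞 ℚ)))
    (hS : ∀ w : HeightOneSpectrum (𝓞 ℚ), w ∉ S →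
      W.HasGoodReductionAt w ∧ W'.HasGoodReductionAt w ∧ (p : 𝓞 ℚ) ∉ w.asIdeal)
    (hdiv' : ∀ P : geomPoints W', ∃ Q : geomPoints W', (p : ℤ) • Q = P)
    (T₁ T₂ : W'.toAffine.Point)
    (hind : ∀ a b : ℤ, a • T₁ + b • T₂ ∈
      (zsmulAddGroupHom (p : ℤ) : W'.toAffine.Point →+ W'.toAffine.Point).range →
      (p : ℤ) ∣ a ∧ (p : ℤ) ∣ b)
    (hloc₁ : ∀ w ∈ S, h1Equiv θ hθ (kummerMapTorsion W' (p : ℤ) hdiv' T₁) ∈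
      selmerLocalKer W (w.adicCompletion ℚ) (p : ℤ))
    (hloc₂ : ∀ w ∈ S, h1Equiv θ hθ (kummerMapTorsion W' (p : ℤ) hdiv' T₂) ∈
      selmerLocalKer W (w.adicCompletion ℚ) (p : ℤ))
    (v : HeightOneSpectrum (𝓞 ℚ))
    (hT₁v : ∃ Q : (W'.baseChange (v.adicCompletion ℚ)).toAffine.Point,
      p • Q = WeierstrassCurve.Affine.Point.baseChange (W' := W') ℚ (v.adicCompletion ℚ) T₁)
    (hT₂v : ∃ Q : (W'.baseChange (v.adicCompletion ℚ)).toAffine.Point,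
      p • Q = WeierstrassCurve.Affine.Point.baseChange (W' := W') ℚ (v.adicCompletion ℚ) T₂)
    (G₀ : W.toAffine.Point)
    (hG₀ : ¬ ∃ Q : (W.baseChange (v.adicCompletion ℚ)).toAffine.Point,
      p • Q = WeierstrassCurve.Affine.Point.baseChange (W' := W) ℚ (v.adicCompletion ℚ) G₀) :
    ∃ f : (Fin 2 → ZMod p) →+ W.sha, Function.Injective f := by
  obtain ⟨G, hG⟩ := exists_generator_rankOne_of_irr (W := W) (p := p) hGZK hirr hr
  -- §2 is stated with the classical `DecidableEq`; over `ℚ` the binders carry `instDecidableEqRat`: transport with `convert`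
  refine exists_injective_of_congr_of_two_witnesses_of_ownPoint W W' hp2 θ hθ S hS hdiv' ⟨G, fun Q ↦ ?_⟩ T₁ T₂
    (fun a b hab ↦ hind a b (by convert hab)) hloc₁ hloc₂ v hT₁v hT₂v G₀ hG₀
  obtain ⟨a, R, h⟩ := hG Q
  exact ⟨a, R, by convert h⟩

/-- **The LOWER half `ord_p #Ш(E)_an ≤ ord_p #Ш(E)` by two-witness + own-point visibility — Cassels–Tate-FREE: the ONLY
named fact is Gross–Zagier–Kolyvagin (`hGZK`: rank `E(ℚ) = 1`, `Ш(E)` finite)** (`p` odd, `E[p]` irreducible, datum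
`#Ш(E)_an = q` with `ord_p q ≤ 2`). Chain: §3 `(ℤ/p)² ↪ Ш(E)` ⟹ `p² ∣ #Ш(E)` (Lagrange, `pow_dvd_shaOrder_of_injective`)
⟹ `ord_p #Ш_an ≤ 2 ≤ ord_p #Ш` (b2b's squareness-free `X11b.missingLowerBoundAt_of_sq_dvd`). Serves the
strict content rows of crux #2″ (and any rank-one content row of any cell whose partner has two locally-divisible
witnesses at a place where the own point is not). Per pair; NOT a class theorem; the crux stays OPEN.
[cite: CremonaMazur2000, §3] [cite: AgasheStein2002, Lemma 3.6] [cite: Miller2011LMS, Def. 1.1 (arXiv:1010.2431 p. 3)] -/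
theorem missingLowerBoundAt_rankOne_irr_of_two_witnesses_of_ownPoint
    (hGZK : rank_eq_analyticRank_of_analyticRank_le_one) (hp2 : p ≠ 2)
    (hirr : Irr W p) (hr : W.analyticRank = 1)
    {q : ℚ} (hq : shaAn W = (q : ℂ)) (hv : padicValRat p q ≤ 2)
    (W' : WeierstrassCurve ℚ) [W'.IsElliptic]
    (θ : geomTorsion W' (p : ℤ) ≃+ geomTorsion W (p : ℤ))
    (hθ : ∀ (σ : absoluteGaloisGroup ℚ) (P : geomTorsion W' (p : ℤ)), θ (σ • P) = σ • θ P)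
    (S : Finset (HeightOneSpectrum (𝓞 ℚ)))
    (hS : ∀ w : HeightOneSpectrum (𝓞 ℚ), w ∉ S →
      W.HasGoodReductionAt w ∧ W'.HasGoodReductionAt w ∧ (p : 𝓞 ℚ) ∉ w.asIdeal)
    (hdiv' : ∀ P : geomPoints W', ∃ Q : geomPoints W', (p : ℤ) • Q = P)
    (T₁ T₂ : W'.toAffine.Point)
    (hind : ∀ a b : ℤ, a • T₁ + b • T₂ ∈
      (zsmulAddGroupHom (p : ℤ) : W'.toAffine.Point →+ W'.toAffine.Point).range →
      (p : ℤ) ∣ a ∧ (p : ℤ) ∣ b)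
    (hloc₁ : ∀ w ∈ S, h1Equiv θ hθ (kummerMapTorsion W' (p : ℤ) hdiv' T₁) ∈
      selmerLocalKer W (w.adicCompletion ℚ) (p : ℤ))
    (hloc₂ : ∀ w ∈ S, h1Equiv θ hθ (kummerMapTorsion W' (p : ℤ) hdiv' T₂) ∈
      selmerLocalKer W (w.adicCompletion ℚ) (p : ℤ))
    (v : HeightOneSpectrum (𝓞 ℚ))
    (hT₁v : ∃ Q : (W'.baseChange (v.adicCompletion ℚ)).toAffine.Point,
      p • Q = WeierstrassCurve.Affine.Point.baseChange (W' := W') ℚ (v.adicCompletion ℚ) T₁)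
    (hT₂v : ∃ Q : (W'.baseChange (v.adicCompletion ℚ)).toAffine.Point,
      p • Q = WeierstrassCurve.Affine.Point.baseChange (W' := W') ℚ (v.adicCompletion ℚ) T₂)
    (G₀ : W.toAffine.Point)
    (hG₀ : ¬ ∃ Q : (W.baseChange (v.adicCompletion ℚ)).toAffine.Point,
      p • Q = WeierstrassCurve.Affine.Point.baseChange (W' := W) ℚ (v.adicCompletion ℚ) G₀) :
    MissingLowerBoundAt W p := by
  have hfinSha : W.ShaFinite := (hGZK W (by rw [hr])).2
  obtain ⟨f, hf⟩ := exists_injective_rankOne_irr_of_two_witnesses_of_ownPoint hGZK hp2 hirr hr W' θ hθ S hS hdiv'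
    T₁ T₂ hind hloc₁ hloc₂ v hT₁v hT₂v G₀ hG₀
  exact Summit.BirchSwinnertonDyer.Rank1Residual.X11b.missingLowerBoundAt_of_sq_dvd W p hfinSha hq hv
    (pow_dvd_shaOrder_of_injective W p f hf)

/-- **The PLACES form** of the Cassels–Tate-free door (the shape of the strict content rows of crux #2″): the separating
place `v ∈ S` is paid by option (a) for BOTH witnesses and the own point `G₀ ∉ p·W(ℚ_v)`; every other place of `S` is free
of kind (i) `w ∤ p ∧ W'(ℚ_w)[p] = 0`, (ii) both split multiplicative with `#W(ℚ_w)[p] ≤ p`, or (iii) both multiplicative,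
`γ(W) = r²γ(W')` in `ℚ_w`, `μ_p(ℚ_w) = 1` (Tate uniformisation = the tree's PROVED `TateCurve.Silverman1994_thmV53_…_holds`).
Binder `hGZK` ONLY. Per pair. [cite: CremonaMazur2000, §3] [cite: SilvermanATAEC1994, Ch. V Thm. 3.1, Thm. 5.3, Cor. 5.4]
[cite: Miller2011LMS, Def. 1.1 (arXiv:1010.2431 p. 3)] -/
theorem missingLowerBoundAt_rankOne_irr_of_two_witnesses_of_ownPoint_of_places
    (hGZK : rank_eq_analyticRank_of_analyticRank_le_one) (hp2 : p ≠ 2)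
    (hirr : Irr W p) (hr : W.analyticRank = 1)
    {q : ℚ} (hq : shaAn W = (q : ℂ)) (hv : padicValRat p q ≤ 2)
    (W' : WeierstrassCurve ℚ) [W'.IsElliptic]
    (θ : geomTorsion W' (p : ℤ) ≃+ geomTorsion W (p : ℤ))
    (hθ : ∀ (σ : absoluteGaloisGroup ℚ) (P : geomTorsion W' (p : ℤ)), θ (σ • P) = σ • θ P)
    (S : Finset (HeightOneSpectrum (𝓞 ℚ)))
    (hS : ∀ w : HeightOneSpectrum (𝓞 ℚ), w ∉ S →
      W.HasGoodReductionAt w ∧ W'.HasGoodReductionAt w ∧ (p : 𝓞 ℚ) ∉ w.asIdeal)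
    (T₁ T₂ : W'.toAffine.Point)
    (hind : ∀ a b : ℤ, a • T₁ + b • T₂ ∈
      (zsmulAddGroupHom (p : ℤ) : W'.toAffine.Point →+ W'.toAffine.Point).range →
      (p : ℤ) ∣ a ∧ (p : ℤ) ∣ b)
    (v : HeightOneSpectrum (𝓞 ℚ)) (hvS : v ∈ S)
    (hT₁v : ∃ Q : (W'.baseChange (v.adicCompletion ℚ)).toAffine.Point,
      p • Q = WeierstrassCurve.Affine.Point.baseChange (W' := W') ℚ (v.adicCompletion ℚ) T₁)
    (hT₂v : ∃ Q : (W'.baseChange (v.adicCompletion ℚ)).toAffine.Point,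
      p • Q = WeierstrassCurve.Affine.Point.baseChange (W' := W') ℚ (v.adicCompletion ℚ) T₂)
    (G₀ : W.toAffine.Point)
    (hG₀ : ¬ ∃ Q : (W.baseChange (v.adicCompletion ℚ)).toAffine.Point,
      p • Q = WeierstrassCurve.Affine.Point.baseChange (W' := W) ℚ (v.adicCompletion ℚ) G₀)
    (hplaces : ∀ w ∈ S, w ≠ v →
      ((p : 𝓞 ℚ) ∉ w.asIdeal ∧ Nat.card (nsmulAddMonoidHom p :
          (W'.baseChange (w.adicCompletion ℚ)).toAffine.Point →+ _).ker = 1) ∨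
      (W.HasSplitMultiplicativeReductionAt w ∧ W'.HasSplitMultiplicativeReductionAt w ∧
        Nat.card (nsmulAddMonoidHom p :
          (W.baseChange (w.adicCompletion ℚ)).toAffine.Point →+ _).ker ≤ p) ∨
      (W.HasMultiplicativeReductionAt w ∧ W'.HasMultiplicativeReductionAt w ∧
        (∃ r : w.adicCompletion ℚ, algebraMap ℚ (w.adicCompletion ℚ) (-(W.c₄ / W.c₆)) =
          r ^ 2 * algebraMap ℚ (w.adicCompletion ℚ) (-(W'.c₄ / W'.c₆))) ∧
        (∀ ζ : w.adicCompletion ℚ, ζ ^ p = 1 → ζ = 1))) :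
    MissingLowerBoundAt W p := by
  have hpp : p.Prime := hp.out
  have hn : (p : ℤ) ≠ 0 := by exact_mod_cast hpp.ne_zero
  have hdiv' : ∀ P : geomPoints W', ∃ Q : geomPoints W', (p : ℤ) • Q = P :=
    W'.zsmul_geomPoints_surjective_holds hn
  -- per-place dispatch for an arbitrary witness `T` that is locally `p`-divisible at `v`
  have hloc : ∀ T : W'.toAffine.Point,
      (∃ Q : (W'.baseChange (v.adicCompletion ℚ)).toAffine.Point,
        p • Q = WeierstrassCurve.Affine.Point.baseChange (W' := W') ℚ (v.adicCompletion ℚ) T) →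
      ∀ w ∈ S, h1Equiv θ hθ (kummerMapTorsion W' (p : ℤ) hdiv' T) ∈ selmerLocalKer W (w.adicCompletion ℚ) (p : ℤ) := by
    intro T hTv w hw
    by_cases hwv : w = v
    · subst hwv
      exact VisibleWitness.h1Equiv_kummerMapTorsion_mem_selmerLocalKer_of_exists_smul_eq W W' θ hθ
        (w.adicCompletion ℚ) hn hdiv' T (hTv.imp fun Q hQ ↦ by rw [natCast_zsmul]; exact hQ)
    have hc : kummerMapTorsion W' (p : ℤ) hdiv' T ∈ selmerLocalKer W' (w.adicCompletion ℚ) (p : ℤ) :=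
      kummerMapTorsion_mem_selmerLocalKer W' _ hdiv' _ T
    rcases hplaces w hw hwv with ⟨hwp, hcard⟩ | ⟨hWw, hW'w, hcardw⟩ | ⟨hWw, hW'w, hγw, hμw⟩
    · exact (relIndex_map_selmerLocalKer_eq_one_iff W W' θ hθ).mp
        (relIndex_map_selmerLocalKer_eq_one_of_card_torsion_eq_one W W' θ hθ hwp hcard) _ hc
    · exact W.h1Equiv_mem_selmerLocalKer_of_hasSplitMultiplicativeReductionAt w
        TateCurve.Silverman1994_thmV53_tateUniformisation_holds W' θ hθ hWw hW'w hcardw hc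
    · exact W.h1Equiv_mem_selmerLocalKer_of_hasMultiplicativeReductionAt w
        TateCurve.Silverman1994_thmV53_corV54_tateUniformisation_holds hp2 W' θ hθ hWw hW'w hγw hμw hc
  exact missingLowerBoundAt_rankOne_irr_of_two_witnesses_of_ownPoint hGZK hp2 hirr hr hq hv W' θ hθ S hS hdiv' T₁ T₂
    hind (hloc T₁ hT₁v) (hloc T₂ hT₂v) v hT₁v hT₂v G₀ hG₀

end RatDoors

end Summit.BirchSwinnertonDyer.BirchSwinnertonDyer.Theorems.VisibleTwoWitnessOwnPoint

end
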